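import Summits.NavierStokesRegularity.FluidComputer.KinkOptimum

/-!
Copyright: pub-fluidc cell (idea-1 lens, gen 12). HONEST FRAMING: low prior, high value-of-information
experiment on Tao's machine paradigm; NOT a claim that NS blows up.

# Corner budget: a floor-keeping relay needs a two-octave budget above `λ² · r_null`,
# and the floor-normalised scalar `J` that answers the LEAD's two-level question by sign

Cell `pub-fluidc` (FLUID COMPUTER; host summit `NavierStokesRegularity`, negation side, machine
paradigm), idea-1 seat gen 12 (variational / optimal-gadget lens). Pre-registration
`HOME/pub-fluidc-idea-1/PREREG-R2.md` §10an (P-G12-3, the level-one ladder law) and §10ao (P-G12-4, the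
lens's cells for the LEAD's question `Q(ν₀/3)` of RULING R43 (iii)(b), and ASK A-G12-3); atlas
`HOME/atlas/IDEA-1.md` §16 (xxii). HONEST FRAMING: low prior, high value-of-information experiment on
Tao's machine paradigm; NOT a claim that NS blows up. Nothing here is about the Navier–Stokes equations:
these are elementary facts about real numbers over the cell's dictionary.

Dictionary (cell units, RULINGS R33 (iii) / R40 (A)). A two-level block has level-one band ratio
`r₁ = U₁,pk/(λ U_in(0)) = g/λ`, physical ratio `r_phys = KinkOptimum.rPhys λ g Π = (g/λ)·min 1 (1/Π) ≤ r₁`,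
level-two ratio `r₂ = U₂,pk/(λ U₁,pk)`, and two-octave BUDGET `Q₂ = U₂,pk/U_in(0) = λ²·r₁·r₂` (`budget`;
the sequence form is `RelayBudget.levelBudget_two_eq`). The LEAD's question asks for a designed field
with `1 ≤ r_phys` (physical floor at level one) AND `r_null < r₂` (relay above passive scaling,
`r_null = λ^(-4/3)`).

* `cornerValue_lt_budget` / `question_needs_budget` — both limbs force `λ²·r_null < Q₂`: the corner of
  the `(r₁, r₂)` plane has a budget price (`λ = 2`: `Q₂ > 1.587`);
* `not_relay_of_budget_le` — contrapositive, the pre-committed MISS wording of P-G12-4 (c): if the best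
  two-octave budget available at `r_phys ≥ 1` is `≤ λ² r_null`, a floor-keeping row cannot relay;
* `one_lt_cornerJ_iff`, `cornerJ_le_one_iff`, `limbs_of_one_lt_cornerJ` — ASK A-G12-3's scalar
  `J = min (r_phys/a) (r₂/b)`: `1 < J ↔ a < r_phys ∧ b < r₂`, so with `a ≥ 1`, `b = r_null` the sign of
  `J − 1` at the optimum IS the (pre-certification) answer to the question;
* `logGain_split` — the ledger identity behind §10an's law `g = (F₁/F₀)·√ε₁`: the log-gain between two
  rungs splits into a coherence term and half an energy-share term (the law says the first vanishes on
  the Reynolds ladder and carries everything under re-design);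
* numeric anchors (`norm_num`): `corner_decimal`, `rowD_budget_without_floor` (row (d) at `ν₀` HAS the
  budget, 1.889, with `r₁ = 0.7505 < 1`: necessary, not sufficient), `rho3_floor_without_budget` (the
  transported field at `ρ = 3` keeps the floor ×1.76 with budget 1.354 < 1.587), `front_point_nu0` (the
  lens's `ν₀` front point `(1.00, 0.40)` sits within 1 % of the corner value).

Provenance: statements and proofs by idea-1 gen 12 (`HOME/pub-fluidc-idea-1/lean/CornerBudget.lean`,
sha16 2e9a9f54c4066804, LEAN ASK #10, cell STATUS l.4408 / idea-1 README gen-12 addition 2); filed through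
the gate by pub-fluidc-lit gen 42 with this header paragraph and three one-line docstrings (`budget_def`,
`cornerValue_def`, `cornerJ_def`, lint.docstring) added; no statement or proof was changed.
-/

namespace Summit.NavierStokesRegularity.FluidComputer.CornerBudget

open Real

/-- Two-octave budget of a two-level block in ratio units: `Q₂ = λ² · r₁ · r₂`. -/
noncomputable def budget (lam r₁ r₂ : ℝ) : ℝ := lam ^ 2 * r₁ * r₂

/-- The corner value `λ² · r_null`: the budget a floor-keeping relay must exceed. -/
noncomputable def cornerValue (lam rnull : ℝ) : ℝ := lam ^ 2 * rnull

/-- ASK A-G12-3's floor-normalised scalar `J = min (r_phys / a) (r₂ / b)`. -/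
noncomputable def cornerJ (a b rphys r₂ : ℝ) : ℝ := min (rphys / a) (r₂ / b)

/-- Unfolding lemma for `budget`. -/
theorem budget_def (lam r₁ r₂ : ℝ) : budget lam r₁ r₂ = lam ^ 2 * r₁ * r₂ := rfl
/-- Unfolding lemma for `cornerValue`. -/
theorem cornerValue_def (lam rnull : ℝ) : cornerValue lam rnull = lam ^ 2 * rnull := rfl
/-- Unfolding lemma for `cornerJ`. -/
theorem cornerJ_def (a b rphys r₂ : ℝ) : cornerJ a b rphys r₂ = min (rphys / a) (r₂ / b) := rfl

/-- Both limbs of the question price the budget: `1 ≤ r₁` and `r_null < r₂` give `λ² r_null < Q₂`. -/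
theorem cornerValue_lt_budget {lam rnull r₁ r₂ : ℝ} (hlam : 0 < lam) (hnull : 0 ≤ rnull)
    (h1 : 1 ≤ r₁) (h2 : rnull < r₂) : cornerValue lam rnull < budget lam r₁ r₂ := by
  unfold cornerValue budget
  have hl : 0 < lam ^ 2 := by positivity
  have hr2 : 0 < r₂ := lt_of_le_of_lt hnull h2
  calc lam ^ 2 * rnull < lam ^ 2 * r₂ := mul_lt_mul_of_pos_left h2 hl
    _ = lam ^ 2 * 1 * r₂ := by ring
    _ ≤ lam ^ 2 * r₁ * r₂ := by
        apply mul_le_mul_of_nonneg_right _ hr2.le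
        exact mul_le_mul_of_nonneg_left h1 hl.le

/-- Contrapositive (P-G12-4 (c), MISS wording): budget at most the corner value and the band floor kept
force `r₂ ≤ r_null` — no relay. -/
theorem not_relay_of_budget_le {lam rnull r₁ r₂ : ℝ} (hlam : 0 < lam) (hnull : 0 ≤ rnull)
    (h1 : 1 ≤ r₁) (hQ : budget lam r₁ r₂ ≤ cornerValue lam rnull) : r₂ ≤ rnull :=
  le_of_not_gt fun h => absurd hQ (not_le_of_gt (cornerValue_lt_budget hlam hnull h1 h))

/-- The physical floor implies the band floor: `1 ≤ r_phys ≤ g/λ = r₁`. -/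
theorem one_le_gain_div_of_one_le_rPhys {lam g Pi : ℝ} (hlam : 0 < lam) (hg : 0 ≤ g)
    (h : 1 ≤ KinkOptimum.rPhys lam g Pi) : 1 ≤ g / lam :=
  h.trans (KinkOptimum.rPhys_le_gain_div hlam hg)

/-- The LEAD's question in budget form: physical floor at level one and relay at level two force
`λ² · r_null < Q₂ = λ² · (g/λ) · r₂`. -/
theorem question_needs_budget {lam g Pi rnull r₂ : ℝ} (hlam : 0 < lam) (hg : 0 ≤ g)
    (hnull : 0 ≤ rnull) (hfloor : 1 ≤ KinkOptimum.rPhys lam g Pi) (hrelay : rnull < r₂) :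
    cornerValue lam rnull < budget lam (g / lam) r₂ :=
  cornerValue_lt_budget hlam hnull (one_le_gain_div_of_one_le_rPhys hlam hg hfloor) hrelay

/-- `1 < J ↔` both normalised margins exceed one. -/
theorem one_lt_cornerJ_iff {a b rphys r₂ : ℝ} (ha : 0 < a) (hb : 0 < b) :
    1 < cornerJ a b rphys r₂ ↔ a < rphys ∧ b < r₂ := by
  unfold cornerJ
  rw [lt_min_iff, one_lt_div ha, one_lt_div hb]

/-- `J ≤ 1 ↔` at least one limb fails (weakly). -/
theorem cornerJ_le_one_iff {a b rphys r₂ : ℝ} (ha : 0 < a) (hb : 0 < b) :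
    cornerJ a b rphys r₂ ≤ 1 ↔ rphys ≤ a ∨ r₂ ≤ b := by
  unfold cornerJ
  rw [min_le_iff, div_le_one ha, div_le_one hb]

/-- With a floor margin `a ≥ 1` and `b = r_null`, `1 < J` gives the two limbs of the question
(pre-certification): `1 ≤ r_phys` (indeed `1 < r_phys`) and `r_null < r₂`. -/
theorem limbs_of_one_lt_cornerJ {a rnull rphys r₂ : ℝ} (ha : 1 ≤ a) (hnull : 0 < rnull)
    (h : 1 < cornerJ a rnull rphys r₂) : 1 ≤ rphys ∧ rnull < r₂ := by
  have ha0 : 0 < a := lt_of_lt_of_le one_pos ha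
  obtain ⟨h1, h2⟩ := (one_lt_cornerJ_iff ha0 hnull).mp h
  exact ⟨ha.trans h1.le, h2⟩

/-- Hence `1 < J` already prices the budget above the corner value. -/
theorem cornerValue_lt_budget_of_one_lt_cornerJ {lam g Pi a rnull r₂ : ℝ} (hlam : 0 < lam)
    (hg : 0 ≤ g) (ha : 1 ≤ a) (hnull : 0 < rnull)
    (h : 1 < cornerJ a rnull (KinkOptimum.rPhys lam g Pi) r₂) :
    cornerValue lam rnull < budget lam (g / lam) r₂ := by
  obtain ⟨h1, h2⟩ := limbs_of_one_lt_cornerJ ha hnull h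
  exact question_needs_budget hlam hg hnull.le h1 h2

/-- The ledger identity behind §10an: `g = F·√ε` at two rungs ⇒ the log-gain splits into a COHERENCE
term and half an ENERGY-SHARE term. -/
theorem logGain_split {F F' ε ε' : ℝ} (hF : 0 < F) (hF' : 0 < F') (hε : 0 < ε) (hε' : 0 < ε') :
    Real.log (F' * Real.sqrt ε' / (F * Real.sqrt ε))
      = Real.log (F' / F) + Real.log (ε' / ε) / 2 := by
  have hs : 0 < Real.sqrt ε := Real.sqrt_pos.mpr hε
  have hs' : 0 < Real.sqrt ε' := Real.sqrt_pos.mpr hε'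
  rw [Real.log_div (by positivity) (by positivity), Real.log_mul hF'.ne' hs'.ne',
    Real.log_mul hF.ne' hs.ne', Real.log_sqrt hε'.le, Real.log_sqrt hε.le,
    Real.log_div hF'.ne' hF.ne', Real.log_div hε'.ne' hε.ne']
  ring

/-- If coherence does not move (`F' = F`), the whole log-gain is the energy term
('Reynolds buys energy, not coherence', read as an identity once `F₁/F₀` is constant). -/
theorem logGain_of_coherence_fixed {F ε ε' : ℝ} (hF : 0 < F) (hε : 0 < ε) (hε' : 0 < ε') :
    Real.log (F * Real.sqrt ε' / (F * Real.sqrt ε)) = Real.log (ε' / ε) / 2 := by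
  rw [logGain_split hF hF hε hε', div_self hF.ne', Real.log_one, zero_add]

/-! ### Numeric anchors (cell rows; `λ = 2`, printed `r_null = 2^(-4/3) = 0.39685…`) -/

/-- The corner value at the printed `r_null`: `4 · 0.39685 = 1.5874`. -/
theorem corner_decimal : cornerValue 2 0.39685 = 1.5874 := by
  norm_num [cornerValue]

/-- Row (d) at `ν₀` (96³ interim it-33): budget `4·0.7505·0.6293 = 1.889 > 1.5874` while `r₁ = 0.7505 < 1`
— the budget is NECESSARY for the corner, not sufficient. -/
theorem rowD_budget_without_floor :
    cornerValue 2 0.39685 < budget 2 0.7505 0.6293 ∧ (0.7505 : ℝ) < 1 := by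
  constructor <;> norm_num [cornerValue, budget]

/-- The transported field at `ρ = 3` (N384 leg): floor kept (`r₁ = 1.7638`) with `r₂ = 0.1920`, budget
`1.3546 < 1.5874` — by `not_relay_of_budget_le` it cannot relay, and indeed `r₂ < r_null`. -/
theorem rho3_floor_without_budget :
    budget 2 1.7638 0.1920 < cornerValue 2 0.39685 ∧ (1 : ℝ) ≤ 1.7638 ∧ (0.1920 : ℝ) < 0.39685 := by
  refine ⟨?_, ?_, ?_⟩ <;> norm_num [cornerValue, budget]

/-- The lens's `ν₀` front point `(r₁, r₂) = (1.00, 0.40)`: budget `1.600`, within 1 % of the corner value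
`1.5874` — 'the corner sits ON the front at ν₀'. -/
theorem front_point_nu0 :
    budget 2 1 0.40 = 1.6 ∧ cornerValue 2 0.39685 < budget 2 1 0.40
      ∧ budget 2 1 0.40 < 1.01 * cornerValue 2 0.39685 := by
  refine ⟨?_, ?_, ?_⟩ <;> norm_num [cornerValue, budget]

/-- ASK A-G12-3's two warm starts at `ν₀/3` sit on opposite sides of the corner in `J` units
(`a = 1.03`, `b = r_null`): start (a) `J = min (1.08/1.03) (0.193/0.39685) < 1` is level-two-limited,
the transported start (d) `J = min (0.84/1.03) (0.70/0.39685) < 1` is level-one-limited. -/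
theorem warm_starts_below_one :
    cornerJ 1.03 0.39685 1.08 0.193 < 1 ∧ cornerJ 1.03 0.39685 0.84 0.70 < 1 := by
  constructor
  · have h : (0.193 : ℝ) / 0.39685 < 1 := by norm_num
    exact lt_of_le_of_lt (min_le_right _ _) h
  · have h : (0.84 : ℝ) / 1.03 < 1 := by norm_num
    exact lt_of_le_of_lt (min_le_left _ _) h

end Summit.NavierStokesRegularity.FluidComputer.CornerBudget
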